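/-
Copyright (c) 2026. All rights reserved.
Released under Apache 2.0 license as described in the file LICENSE.
Authors: abc-iut cell, wave-2 seat abc-iut-L3-t10 (gen 3; proof-only; row «LD-REPAIR» (C′): Thm 3.7 (iii) from a
good covering dictionary).
-/
import Literature.AnabelianGeometry.SemiGraphs.TemperedLevelDictionaryGood
import Literature.AnabelianGeometry.SemiGraphs.TemperedCompactInVerticialOfOneChart
import HarnessLib

/-!
# [SemiAnbd] Theorem 3.7 (iii) from one per-level branch dictionary with covering kernels and good conjugators

Mochizuki, *Semi-graphs of anabelioids*, Publ. RIMS **42** (2006), §3, Theorem 3.7 (iii), manuscript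
pp. 40–41 [cite: MochizukiSemiAnbd2006, Thm 3.7(iii) pp.40-41], with the author's *Comments* (2020) (6)(b) and
Remark 2.2.1 p. 24 / Definition 2.2 (i) p. 23.

PROOF-ONLY (cell row «LD-REPAIR» (C), seat abc-iut-L3-t10 gen 3):

* `FiniteLevelData.compactInVerticial_of_goodLevelDictionary` — a `GoodLevelDictionary 𝒢 c₀` over ONE chart
  (`TemperedLevelDictionaryGood.lean`) satisfying (DB′), (DI′), (DN′) yields both conjuncts of
  `CompactInVerticial` at EVERY chart `c` of `𝒢` and every compact `C` (glue `toFiniteLevelData`, chart transport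
  `FiniteLevelData.nonempty_of_nonempty`, `FiniteLevelData.compactInVerticial`, Thm 3.7 (i)/(ii) by name) — the
  twin of `compactInVerticial_of_levelDictionary` (p413644) for the repaired interface (cell row «LD-REPAIR» (C′),
  ruling α8-2; this is the consumer the producer of (β) targets);
* the kernel certificate O-LD-1 on the v1 `LevelDictionary` is in `TemperedLevelDictionaryObstruction.lean`.

Nothing here takes a side on [IUTchIII] Cor. 3.12.
-/

namespace Literature.AnabelianGeometry.SemiGraphs

namespace ProfiniteSemiGraph

open Topology

universe v u

variable {𝒢 : ProfiniteSemiGraph.{u}}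

namespace FiniteLevelData

/-- **Theorem 3.7 (iii) from ONE per-level branch dictionary with covering kernels and good conjugator sets**
(the producer's deliverable in its repaired form, cell rulings α5-1/α8-2): a `GoodLevelDictionary 𝒢 c₀` over one
chart `c₀` satisfying the three single-level branch obligations (DB′), (DI′), (DN′) yields both conjuncts of
`CompactInVerticial` at EVERY chart `c` of `𝒢` and every compact `C` (glue `GoodLevelDictionary.toFiniteLevelData`,
chart transport, `FiniteLevelData.compactInVerticial`, Thm. 3.7 (i)/(ii) by name). [cite: MochizukiSemiAnbd2006, Thm 3.7(iii) pp.40-41] -/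
theorem compactInVerticial_of_goodLevelDictionary {c₀ : TemperedPiChart 𝒢}
    (X : GoodLevelDictionary.{v} 𝒢 c₀) (h₂ : X.DB) (h₃ : X.DI) (h₄ : X.DN)
    (h𝒢 : 𝒢.Thm37Hypotheses) (c : TemperedPiChart 𝒢) (C : Subgroup c.G)
    (hC : IsCompact (C : Set c.G)) :
    (∃ (v : 𝒢.graph.Vertex) (H : Subgroup c.G), H ∈ verticialSubgroups c v ∧ C ≤ H) ∧
      (C ≠ ⊥ → ∀ (v₁ v₂ : 𝒢.graph.Vertex) (H₁ H₂ : Subgroup c.G), H₁ ∈ verticialSubgroups c v₁ →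
        H₂ ∈ verticialSubgroups c v₂ → H₁ ≠ H₂ → C ≤ H₁ → C ≤ H₂ →
          (∀ (v₃ : 𝒢.graph.Vertex) (H₃ : Subgroup c.G), H₃ ∈ verticialSubgroups c v₃ → C ≤ H₃ →
              H₃ = H₁ ∨ H₃ = H₂) ∧
          ∃ (e : 𝒢.graph.Edge) (L : Subgroup c.G), 𝒢.graph.IsClosedEdge e ∧
            L ∈ edgeLikeSubgroups c e ∧ C ≤ L) := by
  obtain ⟨D⟩ := FiniteLevelData.nonempty_of_nonempty ⟨X.toFiniteLevelData h₂ h₃ h₄⟩ c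
  exact FiniteLevelData.compactInVerticial D verticialDistinct_holds h𝒢
    (fun v => (verticialInjective_holds 𝒢 h𝒢 c v).1) C hC

end FiniteLevelData

end ProfiniteSemiGraph

end Literature.AnabelianGeometry.SemiGraphs
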